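import Summits.CriticalPhenomena.PercolationContinuityZ3.Theses.PercNonProliferation
import Literature.Barriers.CriticalPhenomena.KozmaNachmiasLemma11Steps

/-!
# `FreeBoxSparse` (crux stmt-CriticalPhenomena-4445): tightness — the DCT floor `FA₂(n) ≥ c/n²`,
# the load-bearing normalisation, the exponent of `FreeBoxPowerSaving`, and the parameter `p`

Negative-side analysis (cdisprove, refuter-cdisprove-stmt-CriticalPhenomena-4445-0), all PROVED, for
`FA₂(p, n) := |B(n)|⁻² Σ_{x,y∈B(n)} P_p(x ↔ y in B(n))` (the crux is `FA₂(p_c, n) → 0`):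

* `sum_box_real_openConnIn_ge` — at every `p ≥ p_c` the centred free susceptibility is
  `Σ_{y∈B(n)} P_p(0 ↔ y in B(n)) ≥ (n+1)/6` (Duminil-Copin–Tassion `φ_p(S) ≥ 1`, tree:
  `sum_sphere_real_openConnIn_ge`, summed over the shells `∂B(k)`, `k ≤ n`);
* `pairSum_ge` — `Σ_{x,y∈B(n)} P_p(x ↔ y in B(n)) ≥ (n+1)⁴/12`, hence `freePairAverage_ge`:
  `FA₂(p, n) ≥ 1/(768 (n+1)²)` for `p ≥ p_c` — the crux's quantity cannot decay faster than `n⁻²`;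
* `tendsto_freeSusceptibility_atTop` / `not_tendsto_freeSusceptibility_zero` — NATURAL STRENGTHENING
  REFUTED: with `|B(n)|⁻¹` in place of `|B(n)|⁻²` the quotient diverges (at least linearly);
* `freeBoxPowerSaving_exponent_le_two` — the sibling crux `FreeBoxPowerSaving` (stmt-4447) can only
  hold with exponent `a ≤ 2` (prediction `a = 1 + η ≈ 0.95`);
* `freePairAverage_one` / `not_tendsto_freePairAverage_one` — the parameter is load-bearing: at
  `p = 1`, `FA₂ ≡ 1`;
* `freePairAverage_mono`, `continuous_freePairAverage`, `freePairAverage_criticalProbI_le_of_forall_lt`,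
  `freeBoxSparse_iff_uniform_subcritical` — `p ↦ FA₂(p,n)` is nondecreasing and continuous, so the
  crux is EQUIVALENT to "`FA₂(p, n) → 0` uniformly in `p < p_c`" (for each fixed `p < p_c` it holds).
-/

namespace Summit.CriticalPhenomena.PercolationContinuityZ3.Theorems.FreeBoxSparse.Negative

open MeasureTheory Filter Topology
open Literature.Probability.Percolation Literature.Probability.LatticeModels
open Literature.Barriers.CriticalPhenomena (sum_sphere_real_openConnIn_ge real_openConnIn_shift_box
  mem_image_zdShiftIso_box_iff)
open Summit.CriticalPhenomena.PercolationContinuityZ3.Theses.PercNonProliferation (FreeBoxSparse)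



/-! ### Box bookkeeping -/

/-- `0 < |B(n)|`. [folklore] -/
theorem card_box_pos (n : ℕ) : (0 : ℝ) < (box 3 n).card := by
  exact_mod_cast Finset.card_pos.2 (box_nonempty 3 n)

/-- `|B(n)| = (2n+1)³`. [folklore] -/
theorem card_box_real (n : ℕ) : ((box 3 n).card : ℝ) = (2 * n + 1) ^ 3 := by
  rw [card_box]; push_cast; ring

/-- Monotonicity of `{x ↔ y in S}` in `S`. [folklore] -/
theorem openConnIn_mono' {S S' : Set (Site 3)} (h : S ⊆ S') (x y : Site 3) :
    openConnIn S x y ⊆ openConnIn S' x y := fun _ hω =>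
  DCT16.mem_openConnIn_of_pathIn ((DCT16.pathIn_of_mem_openConnIn hω).mono h)

/-! ### The DCT floor -/

/-- **Centred free susceptibility at `p ≥ p_c`**: `Σ_{y∈B(n)} P_p(0 ↔ y in B(n)) ≥ (n+1)/6`
(`Σ_{z∈∂B(k)} P_p(0 ↔ z in B(k)) ≥ 1/6` for each shell, Duminil-Copin–Tassion / Kozma–Nachmias
Lemma 3.1, tree: `sum_sphere_real_openConnIn_ge`). [folklore] -/
theorem sum_box_real_openConnIn_ge (p : unitInterval)
    (hp : criticalProb (zdGraph 3) (0 : Site 3) ≤ p) (n : ℕ) :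
    ((n : ℝ) + 1) / 6 ≤
      ∑ y ∈ box 3 n, (bondPercolation (zdGraph 3) p).real (openConnIn (↑(box 3 n) : Set (Site 3)) 0 y) := by
  have hdisj : Set.PairwiseDisjoint (↑(Finset.range (n + 1)) : Set ℕ) (sphere 3) := by
    intro j _ k _ hjk
    exact Finset.disjoint_left.2 fun y hyj hyk =>
      hjk ((mem_sphere.1 hyj).symm.trans (mem_sphere.1 hyk))
  have hsub : (Finset.range (n + 1)).biUnion (sphere 3) ⊆ box 3 n := by
    intro y hy
    obtain ⟨k, hk, hyk⟩ := Finset.mem_biUnion.1 hy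
    exact box_mono 3 (by simpa [Nat.lt_succ_iff] using hk) (sphere_subset_box 3 k hyk)
  calc ((n : ℝ) + 1) / 6 = ∑ _k ∈ Finset.range (n + 1), (1 : ℝ) / (2 * (3 : ℕ)) := by
        rw [Finset.sum_const, Finset.card_range, nsmul_eq_mul]; push_cast; ring
    _ ≤ ∑ k ∈ Finset.range (n + 1), ∑ z ∈ sphere 3 k,
          (bondPercolation (zdGraph 3) p).real (openConnIn (↑(box 3 k) : Set (Site 3)) 0 z) :=
        Finset.sum_le_sum fun k _ => sum_sphere_real_openConnIn_ge (d := 3) (by norm_num) p hp k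
    _ ≤ ∑ k ∈ Finset.range (n + 1), ∑ z ∈ sphere 3 k,
          (bondPercolation (zdGraph 3) p).real (openConnIn (↑(box 3 n) : Set (Site 3)) 0 z) := by
        refine Finset.sum_le_sum fun k hk => Finset.sum_le_sum fun z _ => measureReal_mono ?_
        exact openConnIn_mono'
          (Finset.coe_subset.2 (box_mono 3 (by simpa [Nat.lt_succ_iff] using hk))) 0 z
    _ = ∑ z ∈ (Finset.range (n + 1)).biUnion (sphere 3),
          (bondPercolation (zdGraph 3) p).real (openConnIn (↑(box 3 n) : Set (Site 3)) 0 z) :=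
        (Finset.sum_biUnion hdisj).symm
    _ ≤ ∑ y ∈ box 3 n, (bondPercolation (zdGraph 3) p).real (openConnIn (↑(box 3 n) : Set (Site 3)) 0 y) :=
        Finset.sum_le_sum_of_subset_of_nonneg hsub fun _ _ _ => measureReal_nonneg

/-- Translating the root: for `x ∈ B(r)` and `r + k ≤ m`,
`Σ_{z∈B(k)} P_p(0 ↔ z in B(k)) ≤ Σ_{y∈B(m)} P_p(x ↔ y in B(m))`. [folklore] -/
theorem sum_box_real_openConnIn_shift_ge (p : unitInterval) {m r k : ℕ} (hrk : r + k ≤ m)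
    {x : Site 3} (hx : x ∈ box 3 r) :
    ∑ z ∈ box 3 k, (bondPercolation (zdGraph 3) p).real (openConnIn (↑(box 3 k) : Set (Site 3)) 0 z) ≤
      ∑ y ∈ box 3 m, (bondPercolation (zdGraph 3) p).real (openConnIn (↑(box 3 m) : Set (Site 3)) x y) := by
  have himg : (⇑(zdShiftIso x) '' (↑(box 3 k) : Set (Site 3))) ⊆ ↑(box 3 m) := by
    intro w hw
    have hw' : w - x ∈ box 3 k := mem_image_zdShiftIso_box_iff.1 hw
    rw [Finset.mem_coe, mem_box] at *
    intro i
    have h1 := hw' i; have h2 := hx i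
    simp only [Pi.sub_apply] at h1
    constructor <;> omega
  have hinj : Set.InjOn (fun z : Site 3 => z + x) ↑(box 3 k) := fun a _ b _ h => add_right_cancel h
  have hmaps : ∀ z ∈ box 3 k, z + x ∈ box 3 m := fun z hz =>
    Finset.mem_coe.1 (himg ⟨z, Finset.mem_coe.2 hz, by simp [zdShiftIso_apply]⟩)
  calc ∑ z ∈ box 3 k, (bondPercolation (zdGraph 3) p).real (openConnIn (↑(box 3 k) : Set (Site 3)) 0 z)
      = ∑ z ∈ box 3 k, (bondPercolation (zdGraph 3) p).real
          (openConnIn (⇑(zdShiftIso x) '' ↑(box 3 k)) x (z + x)) :=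
        Finset.sum_congr rfl fun z _ => (real_openConnIn_shift_box p x z k).symm
    _ ≤ ∑ z ∈ box 3 k, (bondPercolation (zdGraph 3) p).real
          (openConnIn (↑(box 3 m) : Set (Site 3)) x (z + x)) :=
        Finset.sum_le_sum fun z _ => measureReal_mono (openConnIn_mono' himg x (z + x))
    _ = ∑ y ∈ (box 3 k).image (fun z => z + x),
          (bondPercolation (zdGraph 3) p).real (openConnIn (↑(box 3 m) : Set (Site 3)) x y) :=
        (Finset.sum_image (f := fun y =>
          (bondPercolation (zdGraph 3) p).real (openConnIn (↑(box 3 m) : Set (Site 3)) x y)) hinj).symm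
    _ ≤ ∑ y ∈ box 3 m, (bondPercolation (zdGraph 3) p).real (openConnIn (↑(box 3 m) : Set (Site 3)) x y) := by
        refine Finset.sum_le_sum_of_subset_of_nonneg ?_ fun _ _ _ => measureReal_nonneg
        intro y hy
        obtain ⟨z, hz, rfl⟩ := Finset.mem_image.1 hy
        exact hmaps z hz

/-- **The free pair sum at `p ≥ p_c` is at least `(n+1)⁴/12`.** [folklore] -/
theorem pairSum_ge (p : unitInterval) (hp : criticalProb (zdGraph 3) (0 : Site 3) ≤ p) (m : ℕ) :
    ((m : ℝ) + 1) ^ 4 / 12 ≤ (∑ x ∈ box 3 m, ∑ y ∈ box 3 m, (bondPercolation (zdGraph 3) p).real (openConnIn (↑(box 3 m) : Set (Site 3)) x y)) := by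
  set k : ℕ := m / 2 with hk
  set r : ℕ := m - m / 2 with hr
  have hrk : r + k ≤ m := by omega
  have hr2 : (m : ℝ) + 1 ≤ 2 * r + 1 := by exact_mod_cast (show m + 1 ≤ 2 * r + 1 by omega)
  have hk2 : (m : ℝ) + 1 ≤ 2 * ((k : ℝ) + 1) := by exact_mod_cast (show m + 1 ≤ 2 * (k + 1) by omega)
  have hrow : ∀ x ∈ box 3 r, ((k : ℝ) + 1) / 6 ≤
      ∑ y ∈ box 3 m, (bondPercolation (zdGraph 3) p).real (openConnIn (↑(box 3 m) : Set (Site 3)) x y) :=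
    fun x hx => (sum_box_real_openConnIn_ge p hp k).trans (sum_box_real_openConnIn_shift_ge p hrk hx)
  have hsub : box 3 r ⊆ box 3 m := box_mono 3 (by omega)
  have h1 : ((box 3 r).card : ℝ) * (((k : ℝ) + 1) / 6) ≤ (∑ x ∈ box 3 m, ∑ y ∈ box 3 m, (bondPercolation (zdGraph 3) p).real (openConnIn (↑(box 3 m) : Set (Site 3)) x y)) := by
    calc ((box 3 r).card : ℝ) * (((k : ℝ) + 1) / 6) = ∑ _x ∈ box 3 r, ((k : ℝ) + 1) / 6 := by
          rw [Finset.sum_const, nsmul_eq_mul]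
      _ ≤ ∑ x ∈ box 3 r, ∑ y ∈ box 3 m,
            (bondPercolation (zdGraph 3) p).real (openConnIn (↑(box 3 m) : Set (Site 3)) x y) :=
          Finset.sum_le_sum hrow
      _ ≤ (∑ x ∈ box 3 m, ∑ y ∈ box 3 m, (bondPercolation (zdGraph 3) p).real (openConnIn (↑(box 3 m) : Set (Site 3)) x y)) :=
          Finset.sum_le_sum_of_subset_of_nonneg hsub fun _ _ _ =>
            Finset.sum_nonneg fun _ _ => measureReal_nonneg
  have hcr : ((m : ℝ) + 1) ^ 3 ≤ (box 3 r).card := by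
    rw [card_box_real]
    exact pow_le_pow_left₀ (by positivity) hr2 3
  calc ((m : ℝ) + 1) ^ 4 / 12 = ((m : ℝ) + 1) ^ 3 * (((m : ℝ) + 1) / 2 / 6) := by ring
    _ ≤ ((box 3 r).card : ℝ) * (((k : ℝ) + 1) / 6) := by
        gcongr
        linarith
    _ ≤ (∑ x ∈ box 3 m, ∑ y ∈ box 3 m, (bondPercolation (zdGraph 3) p).real (openConnIn (↑(box 3 m) : Set (Site 3)) x y)) := h1

/-- **`FA₂(p, n) ≥ 1/(768 (n+1)²)` for `p ≥ p_c`.** [folklore] -/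
theorem freePairAverage_ge (p : unitInterval) (hp : criticalProb (zdGraph 3) (0 : Site 3) ≤ p) (m : ℕ) :
    1 / (768 * ((m : ℝ) + 1) ^ 2) ≤ (∑ x ∈ box 3 m, ∑ y ∈ box 3 m, (bondPercolation (zdGraph 3) p).real (openConnIn (↑(box 3 m) : Set (Site 3)) x y)) / ((box 3 m).card : ℝ) ^ 2 := by
  have hcard := card_box_pos m
  rw [le_div_iff₀ (by positivity), card_box_real]
  have hm : (0 : ℝ) ≤ m := Nat.cast_nonneg m
  have h6 : ((2 : ℝ) * m + 1) ^ 6 ≤ 64 * ((m : ℝ) + 1) ^ 6 := by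
    have : (2 : ℝ) * m + 1 ≤ 2 * ((m : ℝ) + 1) := by linarith
    calc ((2 : ℝ) * m + 1) ^ 6 ≤ (2 * ((m : ℝ) + 1)) ^ 6 := pow_le_pow_left₀ (by positivity) this 6
      _ = 64 * ((m : ℝ) + 1) ^ 6 := by ring
  calc 1 / (768 * ((m : ℝ) + 1) ^ 2) * (((2 : ℝ) * m + 1) ^ 3) ^ 2
      = ((2 : ℝ) * m + 1) ^ 6 / (768 * ((m : ℝ) + 1) ^ 2) := by ring
    _ ≤ 64 * ((m : ℝ) + 1) ^ 6 / (768 * ((m : ℝ) + 1) ^ 2) := by gcongr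
    _ = ((m : ℝ) + 1) ^ 4 / 12 := by
        field_simp
        ring
    _ ≤ (∑ x ∈ box 3 m, ∑ y ∈ box 3 m, (bondPercolation (zdGraph 3) p).real (openConnIn (↑(box 3 m) : Set (Site 3)) x y)) := pairSum_ge p hp m

/-- **The crux's quantity at `p_c` is at least `1/(768 (n+1)²)`.** [folklore] -/
theorem freePairAverage_criticalProbI_ge (m : ℕ) :
    1 / (768 * ((m : ℝ) + 1) ^ 2) ≤ (∑ x ∈ box 3 m, ∑ y ∈ box 3 m, (bondPercolation (zdGraph 3) (criticalProbI 3)).real (openConnIn (↑(box 3 m) : Set (Site 3)) x y)) / ((box 3 m).card : ℝ) ^ 2 :=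
  freePairAverage_ge (criticalProbI 3) le_rfl m

/-! ### The normalisation is load-bearing -/

/-- With `|B(n)|⁻¹` in place of `|B(n)|⁻²` the quotient is `≥ (n+1)/96`. [folklore] -/
theorem freeSusceptibility_ge (p : unitInterval) (hp : criticalProb (zdGraph 3) (0 : Site 3) ≤ p) (m : ℕ) :
    ((m : ℝ) + 1) / 96 ≤ (∑ x ∈ box 3 m, ∑ y ∈ box 3 m, (bondPercolation (zdGraph 3) p).real (openConnIn (↑(box 3 m) : Set (Site 3)) x y)) / (box 3 m).card := by
  have hcard := card_box_pos m
  rw [le_div_iff₀ hcard, card_box_real]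
  have h3 : ((2 : ℝ) * m + 1) ^ 3 ≤ 8 * ((m : ℝ) + 1) ^ 3 := by
    have hm : (0 : ℝ) ≤ m := Nat.cast_nonneg m
    have : (2 : ℝ) * m + 1 ≤ 2 * ((m : ℝ) + 1) := by linarith
    calc ((2 : ℝ) * m + 1) ^ 3 ≤ (2 * ((m : ℝ) + 1)) ^ 3 := pow_le_pow_left₀ (by positivity) this 3
      _ = 8 * ((m : ℝ) + 1) ^ 3 := by ring
  calc ((m : ℝ) + 1) / 96 * ((2 : ℝ) * m + 1) ^ 3 ≤ ((m : ℝ) + 1) / 96 * (8 * ((m : ℝ) + 1) ^ 3) := by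
        gcongr
    _ = ((m : ℝ) + 1) ^ 4 / 12 := by ring
    _ ≤ (∑ x ∈ box 3 m, ∑ y ∈ box 3 m, (bondPercolation (zdGraph 3) p).real (openConnIn (↑(box 3 m) : Set (Site 3)) x y)) := pairSum_ge p hp m

/-- The root-averaged free susceptibility at `p_c` diverges (at least linearly). [folklore] -/
theorem tendsto_freeSusceptibility_atTop :
    Tendsto (fun m : ℕ => (∑ x ∈ box 3 m, ∑ y ∈ box 3 m, (bondPercolation (zdGraph 3) (criticalProbI 3)).real (openConnIn (↑(box 3 m) : Set (Site 3)) x y)) / (box 3 m).card) atTop atTop := by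
  refine tendsto_atTop_mono (fun m => freeSusceptibility_ge (criticalProbI 3) le_rfl m) ?_
  refine Tendsto.atTop_div_const (by norm_num) ?_
  exact tendsto_natCast_atTop_atTop.atTop_add tendsto_const_nhds

/-- NATURAL STRENGTHENING REFUTED: the `|B(n)|⁻¹`-normalised variant of the crux is false.
[folklore] -/
theorem not_tendsto_freeSusceptibility_zero :
    ¬ Tendsto (fun m : ℕ => (∑ x ∈ box 3 m, ∑ y ∈ box 3 m, (bondPercolation (zdGraph 3) (criticalProbI 3)).real (openConnIn (↑(box 3 m) : Set (Site 3)) x y)) / (box 3 m).card) atTop (𝓝 0) :=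
  fun h => not_tendsto_nhds_of_tendsto_atTop tendsto_freeSusceptibility_atTop 0 h

/-- **The sibling crux `FreeBoxPowerSaving` (stmt-CriticalPhenomena-4447) can only hold with
exponent `a ≤ 2`.** [folklore] -/
theorem freeBoxPowerSaving_exponent_le_two {a C : ℝ}
    (h : ∀ n : ℕ, 1 ≤ n → (∑ x ∈ box 3 n, ∑ y ∈ box 3 n, (bondPercolation (zdGraph 3) (criticalProbI 3)).real (openConnIn (↑(box 3 n) : Set (Site 3)) x y)) / ((box 3 n).card : ℝ) ^ 2 ≤ C * (n : ℝ) ^ (-a)) : a ≤ 2 := by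
  by_contra ha
  push Not at ha
  have hlim : Tendsto (fun n : ℕ => (n : ℝ) ^ (a - 2)) atTop atTop :=
    (tendsto_rpow_atTop (by linarith)).comp tendsto_natCast_atTop_atTop
  obtain ⟨n, hbig, hn1⟩ :=
    ((hlim.eventually_gt_atTop (3072 * C + 1)).and (eventually_ge_atTop 1)).exists
  have hnpos : (0 : ℝ) < n := by exact_mod_cast hn1
  have hFA := (freePairAverage_criticalProbI_ge n).trans (h n hn1)
  have hn1' : (1 : ℝ) ≤ n := by exact_mod_cast hn1
  have hsq : ((n : ℝ) + 1) ^ 2 ≤ 4 * (n : ℝ) ^ 2 := by nlinarith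
  have hlow : 1 / (3072 * (n : ℝ) ^ 2) ≤ C * (n : ℝ) ^ (-a) := by
    refine le_trans ?_ hFA
    rw [div_le_div_iff₀ (by positivity) (by positivity)]
    linarith
  have hsplit : (n : ℝ) ^ (-a) = ((n : ℝ) ^ (a - 2) * (n : ℝ) ^ 2)⁻¹ := by
    rw [← Real.rpow_natCast, ← Real.rpow_add hnpos, Real.rpow_neg hnpos.le]
    push_cast; ring_nf
  rw [hsplit] at hlow
  have hpow : (0 : ℝ) < (n : ℝ) ^ (a - 2) := Real.rpow_pos_of_pos hnpos _
  have hC : (n : ℝ) ^ (a - 2) ≤ 3072 * C := by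
    have h' := hlow
    rw [div_le_iff₀ (by positivity)] at h'
    have : C * ((n : ℝ) ^ (a - 2) * (n : ℝ) ^ 2)⁻¹ * (3072 * (n : ℝ) ^ 2) =
        3072 * C / (n : ℝ) ^ (a - 2) := by
      field_simp
    rw [this, le_div_iff₀ hpow] at h'
    linarith
  linarith

/-! ### The parameter is load-bearing: `p = 1` -/

/-- At `p = 1`, `P_1(x ↔ y in B(n)) = 1` for `x, y ∈ B(n)` (all lattice edges open, the box is
connected through itself). [folklore] -/
theorem real_openConnIn_box_one {n : ℕ} {x y : Site 3} (hx : x ∈ box 3 n) (hy : y ∈ box 3 n) :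
    (bondPercolation (zdGraph 3) 1).real (openConnIn (↑(box 3 n) : Set (Site 3)) x y) = 1 := by
  have hμ : bondPercolation (zdGraph 3) 1 = Measure.dirac (zdGraph 3).edgeSet := by
    rw [bondPercolation]; exact ProbabilityTheory.setBernoulli_one _
  have hmem : (zdGraph 3).edgeSet ∈ openConnIn (↑(box 3 n) : Set (Site 3)) x y := by
    refine ⟨hx, hy, ?_⟩
    have hG : openGraph ((zdGraph 3).edgeSet) = zdGraph 3 := SimpleGraph.fromEdgeSet_edgeSet _
    rw [hG]
    exact box_induce_reachable n hx hy
  rw [hμ, measureReal_def, Measure.dirac_apply_of_mem hmem, ENNReal.toReal_one]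

/-- At `p = 1`, `FA₂ ≡ 1`. [folklore] -/
theorem freePairAverage_one (n : ℕ) : (∑ x ∈ box 3 n, ∑ y ∈ box 3 n, (bondPercolation (zdGraph 3) 1).real (openConnIn (↑(box 3 n) : Set (Site 3)) x y)) / ((box 3 n).card : ℝ) ^ 2 = 1 := by
  have hcard := card_box_pos n
  rw [div_eq_one_iff_eq (by positivity)]
  calc ∑ x ∈ box 3 n, ∑ y ∈ box 3 n,
        (bondPercolation (zdGraph 3) 1).real (openConnIn (↑(box 3 n) : Set (Site 3)) x y)
      = ∑ x ∈ box 3 n, ∑ y ∈ box 3 n, (1 : ℝ) :=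
        Finset.sum_congr rfl fun x hx => Finset.sum_congr rfl fun y hy => real_openConnIn_box_one hx hy
    _ = ((box 3 n).card : ℝ) ^ 2 := by
        rw [Finset.sum_const, Finset.sum_const, nsmul_eq_mul, nsmul_eq_mul]; ring

/-- **The analogue of the crux at `p = 1` is false.** [folklore] -/
theorem not_tendsto_freePairAverage_one : ¬ Tendsto (fun n : ℕ => (∑ x ∈ box 3 n, ∑ y ∈ box 3 n, (bondPercolation (zdGraph 3) 1).real (openConnIn (↑(box 3 n) : Set (Site 3)) x y)) / ((box 3 n).card : ℝ) ^ 2) atTop (𝓝 0) := by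
  intro h
  have h1 : Tendsto (fun n : ℕ => (∑ x ∈ box 3 n, ∑ y ∈ box 3 n, (bondPercolation (zdGraph 3) 1).real (openConnIn (↑(box 3 n) : Set (Site 3)) x y)) / ((box 3 n).card : ℝ) ^ 2) atTop (𝓝 1) := by
    simp only [freePairAverage_one]; exact tendsto_const_nhds
  exact zero_ne_one (tendsto_nhds_unique h h1)

/-! ### Monotonicity and left-continuity in `p`: the crux is a uniform subcritical statement -/

/-- `FA₂(p, n) ≥ 0`. [folklore] -/
theorem freePairAverage_nonneg (p : unitInterval) (n : ℕ) : 0 ≤ (∑ x ∈ box 3 n, ∑ y ∈ box 3 n, (bondPercolation (zdGraph 3) p).real (openConnIn (↑(box 3 n) : Set (Site 3)) x y)) / ((box 3 n).card : ℝ) ^ 2 :=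
  div_nonneg (Finset.sum_nonneg fun _ _ => Finset.sum_nonneg fun _ _ => measureReal_nonneg) (sq_nonneg _)

/-- `FA₂(p, n)` is nondecreasing in `p` (increasing events, monotone coupling). [folklore] -/
theorem freePairAverage_mono {p q : unitInterval} (hpq : p ≤ q) (n : ℕ) : (∑ x ∈ box 3 n, ∑ y ∈ box 3 n, (bondPercolation (zdGraph 3) p).real (openConnIn (↑(box 3 n) : Set (Site 3)) x y)) / ((box 3 n).card : ℝ) ^ 2 ≤ (∑ x ∈ box 3 n, ∑ y ∈ box 3 n, (bondPercolation (zdGraph 3) q).real (openConnIn (↑(box 3 n) : Set (Site 3)) x y)) / ((box 3 n).card : ℝ) ^ 2 :=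
  div_le_div_of_nonneg_right
    (Finset.sum_le_sum fun x _ => Finset.sum_le_sum fun y _ =>
      DCT16.real_mono_of_isUpperSet (zdGraph 3) (isUpperSet_openConnIn _ x y)
        (DCT16.measurableSet_openConnIn (box 3 n) x y) hpq)
    (sq_nonneg _)

/-- `p ↦ FA₂(p, n)` is continuous (a polynomial in `p`). [folklore] -/
theorem continuous_freePairAverage (n : ℕ) : Continuous fun p : unitInterval => (∑ x ∈ box 3 n, ∑ y ∈ box 3 n, (bondPercolation (zdGraph 3) p).real (openConnIn (↑(box 3 n) : Set (Site 3)) x y)) / ((box 3 n).card : ℝ) ^ 2 := by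
  refine Continuous.div_const (continuous_finsetSum _ fun x _ => continuous_finsetSum _ fun y _ => ?_) _
  exact continuous_bondPercolation_real_of_determinedBy (zdGraph 3)
    (DCT16.determinedBy_openConnIn (↑(box 3 n) : Set (Site 3)) x y (K := ↑(box 3 n).sym2)
      (by rw [Finset.coe_sym2]))

/-- **Left-continuity transfer**: a bound `FA₂(p, n) ≤ c` valid for all `p < p_c` holds at `p_c`.
[folklore] -/
theorem freePairAverage_criticalProbI_le_of_forall_lt (n : ℕ) {c : ℝ}
    (h : ∀ p : unitInterval, (p : ℝ) < criticalProb (zdGraph 3) (0 : Site 3) → (∑ x ∈ box 3 n, ∑ y ∈ box 3 n, (bondPercolation (zdGraph 3) p).real (openConnIn (↑(box 3 n) : Set (Site 3)) x y)) / ((box 3 n).card : ℝ) ^ 2 ≤ c) :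
    (∑ x ∈ box 3 n, ∑ y ∈ box 3 n, (bondPercolation (zdGraph 3) (criticalProbI 3)).real (openConnIn (↑(box 3 n) : Set (Site 3)) x y)) / ((box 3 n).card : ℝ) ^ 2 ≤ c := by
  have hpc : 0 < criticalProb (zdGraph 3) (0 : Site 3) := criticalProb_zd_pos 3 (by norm_num)
  have hclosed : IsClosed {p : unitInterval | (∑ x ∈ box 3 n, ∑ y ∈ box 3 n, (bondPercolation (zdGraph 3) p).real (openConnIn (↑(box 3 n) : Set (Site 3)) x y)) / ((box 3 n).card : ℝ) ^ 2 ≤ c} :=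
    isClosed_le (continuous_freePairAverage n) continuous_const
  have hsub : Set.Iio (criticalProbI 3) ⊆ {p : unitInterval | (∑ x ∈ box 3 n, ∑ y ∈ box 3 n, (bondPercolation (zdGraph 3) p).real (openConnIn (↑(box 3 n) : Set (Site 3)) x y)) / ((box 3 n).card : ℝ) ^ 2 ≤ c} := fun p hp => h p hp
  have hne : (Set.Iio (criticalProbI 3)).Nonempty :=
    ⟨0, show (0 : unitInterval) < criticalProbI 3 by exact_mod_cast hpc⟩
  have hmem : criticalProbI 3 ∈ closure (Set.Iio (criticalProbI 3)) := by
    rw [closure_Iio' hne]; exact Set.self_mem_Iic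
  exact hclosed.closure_subset_iff.2 hsub hmem

/-- **The crux as a uniform subcritical statement**: `FreeBoxSparse` iff for every `ε > 0` there is
`N` such that `FA₂(p, n) < ε` for all `n ≥ N` and all `p < p_c`. [folklore] -/
theorem freeBoxSparse_iff_uniform_subcritical :
    FreeBoxSparse ↔
      ∀ ε : ℝ, 0 < ε → ∃ N : ℕ, ∀ n, N ≤ n → ∀ p : unitInterval,
        (p : ℝ) < criticalProb (zdGraph 3) (0 : Site 3) → (∑ x ∈ box 3 n, ∑ y ∈ box 3 n, (bondPercolation (zdGraph 3) p).real (openConnIn (↑(box 3 n) : Set (Site 3)) x y)) / ((box 3 n).card : ℝ) ^ 2 < ε := by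
  change Tendsto (fun n : ℕ => (∑ x ∈ box 3 n, ∑ y ∈ box 3 n, (bondPercolation (zdGraph 3) (criticalProbI 3)).real (openConnIn (↑(box 3 n) : Set (Site 3)) x y)) / ((box 3 n).card : ℝ) ^ 2) atTop (𝓝 0) ↔ _
  rw [Metric.tendsto_atTop]
  constructor
  · intro h ε hε
    obtain ⟨N, hN⟩ := h ε hε
    refine ⟨N, fun n hn p hp => ?_⟩
    have h1 := hN n hn
    rw [Real.dist_eq, sub_zero, abs_of_nonneg (freePairAverage_nonneg _ n)] at h1
    have hle : p ≤ criticalProbI 3 :=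
      Subtype.coe_le_coe.1 (by rw [coe_criticalProbI]; exact le_of_lt hp)
    exact (freePairAverage_mono hle n).trans_lt h1
  · intro h ε hε
    obtain ⟨N, hN⟩ := h (ε / 2) (by linarith)
    refine ⟨N, fun n hn => ?_⟩
    rw [Real.dist_eq, sub_zero, abs_of_nonneg (freePairAverage_nonneg _ n)]
    have : (∑ x ∈ box 3 n, ∑ y ∈ box 3 n, (bondPercolation (zdGraph 3) (criticalProbI 3)).real (openConnIn (↑(box 3 n) : Set (Site 3)) x y)) / ((box 3 n).card : ℝ) ^ 2 ≤ ε / 2 :=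
      freePairAverage_criticalProbI_le_of_forall_lt n fun p hp => (hN n hn p hp).le
    linarith

end Summit.CriticalPhenomena.PercolationContinuityZ3.Theorems.FreeBoxSparse.Negative
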